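import Literature.Probability.Percolation.OpenPathAnnulusCrossing
import Literature.Probability.Percolation.LatticeWalksGM
import Literature.Probability.Percolation.LatticeSymmetry
import HarnessLib

/-!
# Schramm–Smirnov crossings of a (rotated) half-annulus quad versus lattice half-annulus crossings

Topic `Literature/Probability/Percolation`; proofs only (no definition, no named fact).

The dictionary between the two renderings of "the open edges of `δℤ²` cross the half-annulus
quad `Q = c · {0 ≤ im, 1 ≤ ‖·‖_∞ ≤ L}` from its inner to its outer boundary":

* Schramm–Smirnov's / DKKMO's continuum event `quadCrossing R δ` (`QuadCrossingRotationInvariance`: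
  a point of `R.arc 0` joined to a point of `R.arc 2` by a continuous path inside
  `closure R.carrier ∩ openEdgeUnion δ ω`; O. Schramm, S. Smirnov, Ann. Probab. 39 (2011), §1.3:
  "in the discrete setting there is no difference between connected and path-connected
  crossings"; DKKMO arXiv:2012.11672v1, §1.2), for ANY conformal rectangle `R` whose closed
  carrier and sides `0`, `2` are `c · H_L`, `c · I`, `c · O_L` (`H_L` the closed upper
  half-annulus of sup-radii `1, L`, `I`/`O_L` its inner/outer half-square), and
* the lattice events of `HalfPlaneUCatch.lean` in abstract integer coordinates `X, Y : ℤ² → ℤ`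
  drawn by `meshPoint δ v = c · (X v + i Y v) / ρ`: open crossings of the lattice half-annulus
  `{0 ≤ Y, r ≤ max |X| Y ≤ R}` from `{max |X| Y = r}` to `{max |X| Y = R}`.

With `c = 1`, `(X, Y) = (v₀, v₁)`, `ρ = δ⁻¹` this is the axis half-annulus; with `c = e^{-iπ/4}`,
`(X, Y) = (v₀ - v₁, v₀ + v₁)`, `ρ = √2 δ⁻¹` it is the quad rotated by `-π/4` read on the diagonal
lattice (`ℓ¹` half-annuli of the half-plane `{v₀ + v₁ ≥ 0}`).

* `quadCrossing_of_latticeCrossing` — a lattice crossing from sup-radius `r₁ ≤ ρ` to `R₁ ≥ Lρ`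
  contains a crossing of the quad (its polyline, clipped in the continuum to `ρ ≤ ‖·‖ ≤ Lρ` by
  `exists_clip_Icc`, is a connected compact subset of the closed quad inside the open edges,
  hence a path crossing by `joinedIn_inter_openEdgeUnion_of_isConnected`);
  `real_latticeCrossing_le_quadCrossingProb` — hence `P(lattice) ≤ P(𝒞_δ(Q))`;
* the converse direction (a crossing of the quad is shadowed by an open lattice path) is in
  `HalfAnnulusQuadLatticeShadow.lean`.

## References

* O. Schramm, S. Smirnov, *On the scaling limits of planar percolation*, Ann. Probab. 39 (2011),
  §1.3. [SchrammSmirnov2011]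
* H. Duminil-Copin, K. K. Kozlowski, D. Krachun, I. Manolescu, M. Oulamara, arXiv:2012.11672v1,
  §1.2, Cor. 1.3. [DKKMO2020Rotational]
-/

noncomputable section

namespace Literature.Probability.Percolation

open MeasureTheory Set LatticeModels Complex Metric
open Literature.Probability.RandomPlanarGeometry

namespace HalfPlaneArm

variable {X Y : Site 2 → ℤ}

local notation3 "ν₀[" v "]" => max |X v| (Y v)
local notation3 "ann₀[" r ", " R "]" => {v : Site 2 | 0 ≤ Y v ∧ r ≤ ν₀[v] ∧ ν₀[v] ≤ R}
local notation3 "E₀[" r ", " R "]" =>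
  openCrossing ann₀[r, R] {v : Site 2 | ν₀[v] = r} {v : Site 2 | ν₀[v] = R}
local notation3 "pt[" v "]" => ((X v : ℂ) + (Y v : ℂ) * Complex.I)
/-- The sup-norm of a complex number (local). -/
local notation3 "sn[" w "]" => max |Complex.re w| |Complex.im w|
local notation3 "Hann[" L "]" => {w : ℂ | 0 ≤ w.im ∧ 1 ≤ sn[w] ∧ sn[w] ≤ L}
local notation3 "Iarc" => {w : ℂ | 0 ≤ w.im ∧ sn[w] = 1}
local notation3 "Oarc[" L "]" => {w : ℂ | 0 ≤ w.im ∧ sn[w] = L}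

/-! ### Elementary facts on the sup-norm -/

/-- The sup-norm is subadditive with respect to coordinatewise differences. [folklore] -/
theorem sn_le_sn_add (w w' : ℂ) : sn[w] ≤ sn[w'] + sn[w - w'] := by
  refine max_le ?_ ?_
  · calc |w.re| = |w'.re + (w - w').re| := by simp
      _ ≤ |w'.re| + |(w - w').re| := abs_add_le _ _
      _ ≤ sn[w'] + sn[w - w'] := add_le_add (le_max_left _ _) (le_max_left _ _)
  · calc |w.im| = |w'.im + (w - w').im| := by simp
      _ ≤ |w'.im| + |(w - w').im| := abs_add_le _ _
      _ ≤ sn[w'] + sn[w - w'] := add_le_add (le_max_right _ _) (le_max_right _ _)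

/-- The sup-norm is dominated by the Euclidean norm. [folklore] -/
theorem sn_le_norm (w : ℂ) : sn[w] ≤ ‖w‖ := max_le (abs_re_le_norm w) (abs_im_le_norm w)

/-- The sup-norm is `1`-Lipschitz for the Euclidean norm (two-sided form). [folklore] -/
theorem abs_sn_sub_sn_le (w w' : ℂ) : |sn[w] - sn[w']| ≤ ‖w - w'‖ := by
  rw [abs_le]
  constructor
  · have := sn_le_sn_add w' w
    rw [← norm_neg, neg_sub]
    linarith [sn_le_norm (w' - w)]
  · linarith [sn_le_sn_add w w', sn_le_norm (w - w')]

/-- Sup-norm of a positive real multiple. [folklore] -/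
theorem sn_real_mul {ρ : ℝ} (hρ : 0 ≤ ρ) (w : ℂ) : sn[(ρ : ℂ) * w] = ρ * sn[w] := by
  simp only [re_ofReal_mul, im_ofReal_mul, abs_mul, abs_of_nonneg hρ]
  exact (mul_max_of_nonneg _ _ hρ).symm

/-- The sup-norm of the drawn integer point `X v + i Y v`. [folklore] -/
theorem sn_pt (v : Site 2) : sn[pt[v]] = max |(X v : ℝ)| |(Y v : ℝ)| := by
  simp

/-- In the half-plane, `max |X| Y` is the sup-norm. [folklore] -/
theorem cast_norm_eq {v : Site 2} (hv : 0 ≤ Y v) : ((ν₀[v] : ℤ) : ℝ) = max |(X v : ℝ)| |(Y v : ℝ)| := by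
  rw [abs_of_nonneg (show (0 : ℝ) ≤ Y v by exact_mod_cast hv)]
  push_cast
  rfl

/-! ### The pull-back coordinates `T z = (ρ / c) z` -/

section Geometry

variable {c : ℂ} {ρ δ : ℝ} (hc : c ≠ 0) (hρ : 0 < ρ) (hδ : 0 < δ)
  (hmesh : ∀ v : Site 2, meshPoint δ v = c * ((X v : ℂ) + (Y v : ℂ) * Complex.I) / ρ)

include hc hρ hmesh in
/-- The drawn lattice point pulls back to the integer point. [folklore] -/
theorem T_meshPoint (v : Site 2) : (ρ : ℂ) / c * meshPoint δ v = pt[v] := by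
  rw [hmesh]
  have hρ' : (ρ : ℂ) ≠ 0 := ofReal_ne_zero.2 hρ.ne'
  field_simp

include hc in
/-- A point of `c · S` pulls back to `ρ · S`. [folklore] -/
theorem T_image {S : Set ℂ} {z : ℂ} (hz : z ∈ (fun w => c * w) '' S) :
    ∃ w ∈ S, (ρ : ℂ) / c * z = (ρ : ℂ) * w := by
  obtain ⟨w, hw, rfl⟩ := hz
  exact ⟨w, hw, by field_simp⟩

include hc hρ in
/-- Conversely, `z = c · (T z / ρ)`. [folklore] -/
theorem eq_mul_T_div (z : ℂ) : z = c * ((ρ : ℂ) / c * z / ρ) := by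
  have hρ' : (ρ : ℂ) ≠ 0 := ofReal_ne_zero.2 hρ.ne'
  field_simp

include hc hρ hδ hmesh in
/-- **Integer points are within sup-distance `< 2` of the pulled-back points of their edges**:
if `ρ δ < 2 ‖c‖`, then for adjacent `v, w` and `z` on the drawn segment `[δv, δw]`,
`‖(X v + i Y v) - T z‖ < 2`. [folklore] -/
theorem norm_pt_sub_T_lt (hκ : ρ * δ < 2 * ‖c‖) {v w : Site 2} (hvw : (zdGraph 2).Adj v w) {z : ℂ}
    (hz : z ∈ segment ℝ (meshPoint δ v) (meshPoint δ w)) : ‖pt[v] - (ρ : ℂ) / c * z‖ < 2 := by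
  have h1 : pt[v] - (ρ : ℂ) / c * z = (ρ : ℂ) / c * (meshPoint δ v - z) := by
    rw [mul_sub, T_meshPoint hc hρ hmesh]
  rw [h1, norm_mul, norm_div, Complex.norm_of_nonneg hρ.le]
  have hd : ‖meshPoint δ v - z‖ ≤ δ := by
    rw [← dist_eq_norm]; exact dist_meshPoint_le_of_mem_segment hδ hvw hz
  have hcpos : 0 < ‖c‖ := norm_pos_iff.2 hc
  calc ρ / ‖c‖ * ‖meshPoint δ v - z‖ ≤ ρ / ‖c‖ * δ := by gcongr
    _ = ρ * δ / ‖c‖ := by ring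
    _ < 2 := by rw [div_lt_iff₀ hcpos]; exact hκ

/-- Integer consequences of `‖(X v + i Y v) - u‖ < 2`: the coordinates of `v` are within `2` of
those of `u`, hence `Y v ≥ -1` if `im u ≥ 0`, and the sup-norms differ by less than `2`.
[folklore] -/
theorem coords_of_norm_lt {v : Site 2} {u : ℂ} (h : ‖pt[v] - u‖ < 2) :
    |(X v : ℝ) - u.re| < 2 ∧ |(Y v : ℝ) - u.im| < 2 ∧ |max |(X v : ℝ)| |(Y v : ℝ)| - sn[u]| < 2 := by
  refine ⟨?_, ?_, ?_⟩
  · have := abs_re_le_norm (pt[v] - u)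
    simp only [sub_re, add_re, intCast_re, mul_re, I_re, mul_zero, intCast_im, I_im, mul_one,
      sub_self, add_zero] at this
    linarith
  · have := abs_im_le_norm (pt[v] - u)
    simp only [sub_im, add_im, intCast_im, mul_im, I_re, mul_zero, intCast_re, I_im, mul_one,
      zero_add, add_zero] at this
    linarith
  · have := abs_sn_sub_sn_le pt[v] u
    rw [sn_pt] at this
    linarith

include hρ in
/-- Sup-norm and imaginary part of `u / ρ`. [folklore] -/
theorem sn_div_im_div (u : ℂ) : sn[u / ρ] = sn[u] / ρ ∧ (u / ρ).im = u.im / ρ := by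
  have e : u / (ρ : ℂ) = ((ρ⁻¹ : ℝ) : ℂ) * u := by
    rw [ofReal_inv, div_eq_inv_mul]
  rw [e, sn_real_mul (inv_nonneg.2 hρ.le), im_ofReal_mul]
  constructor <;> ring

/-- The half-plane `{0 ≤ im (T z)}` is convex. [folklore] -/
theorem convex_im_T_nonneg (c : ℂ) (ρ : ℝ) : Convex ℝ {z : ℂ | 0 ≤ ((ρ : ℂ) / c * z).im} := by
  intro z₁ hz₁ z₂ hz₂ a b ha hb _
  simp only [mem_setOf_eq] at hz₁ hz₂ ⊢
  have e : (ρ : ℂ) / c * (a • z₁ + b • z₂) = (a : ℂ) * ((ρ : ℂ) / c * z₁) + (b : ℂ) * ((ρ : ℂ) / c * z₂) := by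
    rw [Complex.real_smul, Complex.real_smul]; ring
  rw [e, add_im, im_ofReal_mul, im_ofReal_mul]
  positivity

end Geometry

/-! ### A lattice crossing of the half-annulus crosses the quad -/

section Sandwich

variable (hX : ∀ u v, (zdGraph 2).Adj u v → X v ≤ X u + 1) (hY : ∀ u v, (zdGraph 2).Adj u v → Y v ≤ Y u + 1)

include hX hY in
/-- `max |X| Y` moves by at most one along an edge. [folklore] -/
theorem supNorm_le_of_adj (u v : Site 2) (h : (zdGraph 2).Adj u v) : ν₀[v] ≤ ν₀[u] + 1 := by
  have h1 := hX u v h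
  have h2 := hX v u h.symm
  have h3 := hY u v h
  have hxu : |X u| ≤ ν₀[u] := le_max_left _ _
  have hyu : Y u ≤ ν₀[u] := le_max_right _ _
  have habs := abs_le.1 hxu
  refine max_le ?_ (by omega)
  rw [abs_le]; constructor <;> omega

/-- **A lattice crossing of the half-annulus is a crossing of the quad.** Let the conformal
rectangle `R` have closed carrier `c · H_L` and sides `R.arc 0 = c · I`, `R.arc 2 = c · O_L`, and let
the lattice be drawn by `meshPoint δ v = c (X v + i Y v) / ρ` with `Y ≥ 0` on the region. On a
lattice configuration, an open crossing of `{0 ≤ Y, r₁ ≤ max |X| Y ≤ R₁}` from `{max |X| Y = r₁}`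
to `{max |X| Y = R₁}` with `r₁ ≤ ρ < L ρ ≤ R₁` gives `ω ∈ quadCrossing R δ`: the drawn polyline of
the open walk lies in the drawn open edges and in the convex half-plane `c · {im ≥ 0}`; its
sup-level `t ↦ ‖T γ(t)‖_∞` is clipped to `[ρ, Lρ]` (`exists_clip_Icc`), and the clipped piece is
a connected compact subset of `closure R.carrier ∩ openEdgeUnion δ ω` from `R.arc 0` to `R.arc 2`,
inside which its ends are joined by a path (`joinedIn_inter_openEdgeUnion_of_isConnected`).
[cite: SchrammSmirnov2011, §1.3 ("no difference between connected and path-connected crossings")] -/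
theorem quadCrossing_of_latticeCrossing {R : ConformalRectangle} {c : ℂ} {ρ δ L : ℝ} (hc : c ≠ 0)
    (hρ : 0 < ρ) (hδ : 0 < δ) (hL : 1 ≤ L)
    (hcl : closure R.carrier = (fun w => c * w) '' Hann[L])
    (h0 : R.arc 0 = (fun w => c * w) '' Iarc) (h2 : R.arc 2 = (fun w => c * w) '' Oarc[L])
    (hmesh : ∀ v : Site 2, meshPoint δ v = c * pt[v] / ρ)
    {ω : BondConfig (Site 2)} (hω : ω ⊆ (zdGraph 2).edgeSet) {r₁ R₁ : ℤ}
    (hr₁ρ : (r₁ : ℝ) ≤ ρ) (hR₁ : L * ρ ≤ R₁) (hlt : r₁ < R₁) (h : ω ∈ E₀[r₁, R₁]) :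
    ω ∈ quadCrossing R δ := by
  obtain ⟨x, hx, y, hy, hxy⟩ := h
  have hx : ν₀[x] = r₁ := hx
  have hy : ν₀[y] = R₁ := hy
  have hx0 : 0 ≤ Y x := hxy.1.1
  have hy0 : 0 ≤ Y y := hxy.2.1.1
  obtain ⟨W, hWs, hWe⟩ := exists_walk_of_mem_openConnIn hω hxy
  have hnil : ¬ W.Nil := by
    intro hn
    have := hn.eq
    subst this
    omega
  set T : ℂ → ℂ := fun z => (ρ : ℂ) / c * z with hT
  set γ := W.toCurve (meshPoint δ) with hγdef
  -- the polyline lies in the open edges and in the pulled-back half-plane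
  have hγO : range γ ⊆ openEdgeUnion δ ω := by
    refine (range_toCurve_subset_iUnion (meshPoint δ) hnil).trans ?_
    intro z hz
    simp only [mem_iUnion] at hz
    obtain ⟨d, hd, hz⟩ := hz
    exact mem_openEdgeUnion_iff.2 ⟨d.fst, d.snd, d.adj, hWe _ (List.mem_map.2 ⟨d, hd, rfl⟩), hz⟩
  have hγim : range γ ⊆ {z : ℂ | 0 ≤ (T z).im} :=
    range_toCurve_subset_of_convex _ W (convex_im_T_nonneg c ρ) fun v hv => by
      show 0 ≤ ((ρ : ℂ) / c * meshPoint δ v).im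
      rw [T_meshPoint hc hρ hmesh]
      simp only [add_im, intCast_im, mul_im, intCast_re, I_im, mul_one, I_re, mul_zero, add_zero,
        zero_add]
      exact_mod_cast (hWs v hv).1
  -- the continuum parametrisation on `ℝ` and its sup-level
  set Γ : ℝ → ℂ := fun t => γ (projIcc 0 1 zero_le_one t) with hΓ
  have hΓc : Continuous Γ := γ.continuous.comp continuous_projIcc
  have hΓγ : ∀ t, Γ t ∈ range γ := fun t => ⟨_, rfl⟩
  set g : ℝ → ℝ := fun t => sn[T (Γ t)] with hg
  have hTc : Continuous fun t => T (Γ t) := continuous_const.mul hΓc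
  have hgc : Continuous g :=
    (continuous_abs.comp (continuous_re.comp hTc)).max (continuous_abs.comp (continuous_im.comp hTc))
  have hΓ0 : Γ 0 = meshPoint δ x := by
    simp only [hΓ, projIcc_left]; exact SimpleGraph.Walk.toCurve_apply_zero _ _
  have hΓ1 : Γ 1 = meshPoint δ y := by
    simp only [hΓ, projIcc_right]; exact toCurve_one _ _
  have hg0 : g 0 = r₁ := by
    simp only [hg, hΓ0]
    show sn[(ρ : ℂ) / c * meshPoint δ x] = r₁
    rw [T_meshPoint hc hρ hmesh, sn_pt, ← cast_norm_eq hx0, hx]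
  have hg1 : g 1 = R₁ := by
    simp only [hg, hΓ1]
    show sn[(ρ : ℂ) / c * meshPoint δ y] = R₁
    rw [T_meshPoint hc hρ hmesh, sn_pt, ← cast_norm_eq hy0, hy]
  obtain ⟨s₀, s₁, -, hs₀₁, -, hgs₀, hgs₁, hgI⟩ := exists_clip_Icc hgc.continuousOn (a₁ := ρ) (a₂ := L * ρ)
    (by nlinarith) (by rw [hg0]; exact hr₁ρ) (by rw [hg1]; exact hR₁)
  -- the clipped piece
  set K := Γ '' Icc s₀ s₁ with hK
  have hKc : IsCompact K := isCompact_Icc.image hΓc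
  have hKconn : IsConnected K := (isConnected_Icc hs₀₁).image Γ hΓc.continuousOn
  have hKγ : K ⊆ range γ := by rintro _ ⟨t, -, rfl⟩; exact hΓγ t
  have memH : ∀ t ∈ Icc s₀ s₁, Γ t ∈ closure R.carrier := fun t ht => by
    rw [hcl]
    have him : 0 ≤ (T (Γ t)).im := hγim (hΓγ t)
    obtain ⟨hsn1, hsn2⟩ := hgI t ht
    obtain ⟨e1, e2⟩ := sn_div_im_div hρ (T (Γ t))
    refine ⟨T (Γ t) / ρ, ⟨?_, ?_, ?_⟩, (eq_mul_T_div hc hρ (Γ t)).symm⟩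
    · rw [e2]; positivity
    · rw [e1, le_div_iff₀ hρ, one_mul]; exact hsn1
    · rw [e1, div_le_iff₀ hρ]; exact hsn2
  have ha : Γ s₀ ∈ R.arc 0 := by
    rw [h0]
    have him : 0 ≤ (T (Γ s₀)).im := hγim (hΓγ s₀)
    obtain ⟨e1, e2⟩ := sn_div_im_div hρ (T (Γ s₀))
    refine ⟨T (Γ s₀) / ρ, ⟨?_, ?_⟩, (eq_mul_T_div hc hρ (Γ s₀)).symm⟩
    · rw [e2]; positivity
    · rw [e1, div_eq_one_iff_eq hρ.ne']; exact hgs₀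
  have hb : Γ s₁ ∈ R.arc 2 := by
    rw [h2]
    have him : 0 ≤ (T (Γ s₁)).im := hγim (hΓγ s₁)
    obtain ⟨e1, e2⟩ := sn_div_im_div hρ (T (Γ s₁))
    refine ⟨T (Γ s₁) / ρ, ⟨?_, ?_⟩, (eq_mul_T_div hc hρ (Γ s₁)).symm⟩
    · rw [e2]; positivity
    · rw [e1, div_eq_iff hρ.ne']; exact hgs₁
  have hJ := joinedIn_inter_openEdgeUnion_of_isConnected hδ (C := closure R.carrier) hKc hKconn
    (hKγ.trans hγO) (by rintro _ ⟨t, ht, rfl⟩; exact memH t ht) ⟨s₀, left_mem_Icc.2 hs₀₁, rfl⟩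
    ⟨s₁, right_mem_Icc.2 hs₀₁, rfl⟩
  exact ⟨Γ s₀, ha, Γ s₁, hb, hJ⟩

end Sandwich

/-! ### Probability form of the first inclusion -/

section SandwichProb

/-- **`P[lattice crossing of a slightly wider half-annulus] ≤ P[𝒞_δ(Q)]`** (probability form of
`quadCrossing_of_latticeCrossing`, the lattice configurations having full measure).
[cite: SchrammSmirnov2011, §1.3] -/
theorem real_latticeCrossing_le_quadCrossingProb {R : ConformalRectangle} {c : ℂ} {ρ δ L : ℝ}
    (hc : c ≠ 0) (hρ : 0 < ρ) (hδ : 0 < δ) (hL : 1 ≤ L)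
    (hcl : closure R.carrier = (fun w => c * w) '' Hann[L])
    (h0 : R.arc 0 = (fun w => c * w) '' Iarc) (h2 : R.arc 2 = (fun w => c * w) '' Oarc[L])
    (hmesh : ∀ v : Site 2, meshPoint δ v = c * pt[v] / ρ) {r₁ R₁ : ℤ}
    (hr₁ρ : (r₁ : ℝ) ≤ ρ) (hR₁ : L * ρ ≤ R₁) (hlt : r₁ < R₁) :
    (bondPercolation (zdGraph 2) half).real E₀[r₁, R₁] ≤ quadCrossingProb δ R := by
  refine ENNReal.toReal_mono (measure_ne_top _ _) (measure_mono_ae ?_)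
  filter_upwards [ae_subset_edgeSet (zdGraph 2) half] with ω hω h
  exact quadCrossing_of_latticeCrossing hc hρ hδ hL hcl h0 h2 hmesh hω hr₁ρ hR₁ hlt h

end SandwichProb

end HalfPlaneArm

end Literature.Probability.Percolation
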